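import Summits.BirchSwinnertonDyer.BirchSwinnertonDyer.Theses.CMKolyvaginAtInertTwo
import HarnessLib

set_option linter.dupNamespace false -- `Summit.BirchSwinnertonDyer.BirchSwinnertonDyer.Theorems.…` (summit = sub)
set_option autoImplicit false

/-!
# Crux `CMKolyvaginConjectureAtInertTwo` (stmt-BirchSwinnertonDyer-24648), line `birth` (KC_birth, pen
# bsd-idea-1 g3, skeleton sha `f3c3ea09…`), registered stub `stub_levelOne`: the depth-zero case

Route `CMKolyvaginAtInertTwo` (cell `pub/bsd-print-cf2`, prover seat `bsd-line-cmk2-p1` g6).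
The registered birth skeleton splits Kolyvagin's conjecture at `p = 2` on the habitat H₂ by the
`2`-divisibility of the basic Heegner point `y_K = P(1)` in `E(K[1])`:

* `stub_levelOne` (THIS FILE, verbatim): if `y_K = d₁.derivedPoint ∉ 2·E(K[1])`, then a square-free
  product `n` of Kolyvagin primes at `2` inert in `F` with `P(n) ∉ 2E(K[n])` exists — namely `n = 1`,
  `d := d₁` (the empty product: `Squarefree 1`, `(1 : ℕ).primeFactors = ∅`), the certificate being the
  hypothesis itself;
* `stub_positiveDepth` (NOT here; the conjecture proper): the case `y_K ∈ 2·E(K[1])`.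

THEOREMS ONLY (no definition, no named fact, no `sorry`); nothing about any curve is asserted beyond
logic. Supports, does not close, stmt-BirchSwinnertonDyer-24648. Kolyvagin's conjecture at `2` is NOT
proved by this (its content is the other stub); BSD is not proved by this.

References: [Kolyvagin1991] (the conjecture, `p` odd); [GrossLMS1991] §3 (the classes `P(n)`).
-/

namespace Summit.BirchSwinnertonDyer.BirchSwinnertonDyer.Theorems.CMKolyvaginAtInertTwoCMKolyvaginConjectureAtInertTwoStubLevelOne

/-- **Registered stub `stub_levelOne` of crux 24648 (verbatim).** On the habitat H₂ (CM, `2` inert in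
`F`, `ρ̄_{E,2}` onto, `r_an = 1`, odd Tamagawa product), for every admissible Heegner field `K`, every
optimal odd-Manin frame `Dt, β, ι` and `y_K = d₁.derivedPoint` of infinite order: if `y_K` is not
`2`-divisible in `E(K[1])` then some square-free product `n` of Kolyvagin primes at `2` inert in `F`
carries a derived point `P(n) ∉ 2E(K[n])`. Witness: `n = 1`, `d = d₁` (no prime factors; the
divisibility clause is the hypothesis). None of the arithmetic hypotheses is used — this is the
depth-zero leg of the `by_cases` in the skeleton's `CMKolyvaginConjectureAtInertTwo_of`.
[cite: GrossLMS1991, §3] -/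
theorem stub_levelOne :
    ∀ (W : WeierstrassCurve ℚ) [W.IsElliptic] [W.IsGloballyMinimal] [NeZero (W.conductorNorm ℤ)], W.HasCM → Literature.NumberTheory.EllipticCurves.Rank1Residual.CMInert W 2 → W.HasSurjectiveModNGaloisRep (2 : ℤ) → W.analyticRank = 1 → Odd W.tamagawaProduct → ∀ (K : Type) [Field K] [NumberField K], Literature.NumberTheory.EllipticCurves.IsImaginaryQuadratic K → Odd (NumberField.discr K) → NumberField.discr K ≠ -3 → Literature.NumberTheory.EllipticCurves.SatisfiesHeegnerHypothesis (W.conductorNorm ℤ) K → ∀ (Dt : Literature.NumberTheory.EllipticCurves.ModularForms.ModularParametrizationData W (W.conductorNorm ℤ)), (∀ z ∈ Dt.L.lattice, ∃ w ∈ Literature.NumberTheory.EllipticCurves.ModularForms.periodLattice Dt.f, z = (Dt.c : ℂ) * w) → Odd Dt.c → ∀ (β : ℤ) (ι : K →+* ℂ) (d₁ : Literature.NumberTheory.EllipticCurves.KolyvaginHeegnerData Dt β ι 1), ¬ IsOfFinAddOrder d₁.derivedPoint → ¬ (∃ Q : (W.baseChange (Literature.NumberTheory.EllipticCurves.ringClassField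 K ι 1)).toAffine.Point, (2 : ℤ) • Q = d₁.derivedPoint) → ∃ (n : ℕ) (d : Literature.NumberTheory.EllipticCurves.KolyvaginHeegnerData Dt β ι n), Squarefree n ∧ (∀ ℓ ∈ n.primeFactors, (Literature.NumberTheory.EllipticCurves.Zhang2014.IsKolyvaginPrime (W.conductorNorm ℤ) W K 2 ℓ ∧ Literature.NumberTheory.EllipticCurves.Rank1Residual.CMInert W ℓ)) ∧ ¬ ∃ Q : (W.baseChange (Literature.NumberTheory.EllipticCurves.ringClassField K ι n)).toAffine.Point, (2 : ℤ) • Q = d.derivedPoint := by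
  intro W _ _ _ _ _ _ _ _ K _ _ _ _ _ _ Dt _ _ β ι d₁ _ hndiv
  exact ⟨1, d₁, squarefree_one, fun ℓ hℓ ↦ absurd hℓ (by simp), hndiv⟩

end Summit.BirchSwinnertonDyer.BirchSwinnertonDyer.Theorems.CMKolyvaginAtInertTwoCMKolyvaginConjectureAtInertTwoStubLevelOne
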